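import Mathlib
import HarnessLib

/-!
# A Chebyshev-type bound: `lcm(1,…,n)³ ≤ K · 32ⁿ`

An elementary, fully explicit upper bound for `dₙ = lcm(1,…,n)` (Mathlib's `Nat.lcmUpto`) of the
strength needed in Apéry's proof of the irrationality of `ζ(3)`: there, `dₙ³ εₙ → 0` requires
`dₙ³ ≪ λⁿ` for some `λ < (1+√2)⁴ = 33.97…`; we prove `dₙ³ ≤ K · 32ⁿ` (`λ = 32`, i.e.
`dₙ ≤ K' · 2^{5n/3}`, `log 2^{5/3} = 1.155…`). Mathlib's `Chebyshev.psi_le`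
(`ψ(x) ≤ x log 4 + 2√x log x`, from `primorial_le_four_pow`) only gives `dₙ³ ≲ 64ⁿ`, so we run
Chebyshev's original (1852) argument with the multinomial-type quotient
`Cₙ = n! ⌊n/30⌋! / (⌊n/2⌋! ⌊n/3⌋! ⌊n/5⌋!)`:

* `chebyshev_floor_ineq`, `legendre_step`, `lcmUpto_mul_factorials_dvd`: Legendre's formula and
  the fact that `⌊x⌋ - ⌊x/2⌋ - ⌊x/3⌋ - ⌊x/5⌋ + ⌊x/30⌋ ∈ {0,1}` equals `1` on `[1,6)` give the
  divisibility `dₙ · ⌊n/2⌋! ⌊n/3⌋! ⌊n/5⌋! ∣ n! ⌊n/30⌋! · d_{⌊n/6⌋}`, i.e. `dₙ ≤ Cₙ d_{⌊n/6⌋}`;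
* `factorial_thirty_mul_le`: at `n = 30k`, `C_{30k} = C(30k,15k) C(15k,5k) / C(6k,k) ≤
  2^{30k} · (3^{15k}/2^{10k}) / 6^k = (2¹⁹ 3¹⁴)^k` (binomial theorem bounds; the true rate is
  `30³⁰/(15¹⁵10¹⁰6⁶) = 2¹⁴3⁹5⁵` per `k`, we can afford the loss);
* `lcmUpto_thirty_mul_le_pow`: iterating `d_{30k} ≤ (2¹⁹3¹⁴)^k d_{5k}` with `3⁸⁴ < 2¹³⁴` gives
  `d_{30k} ≤ d_{3750} · 2^{50k}` for all `k`, whence `dₙ³ ≤ d_{3750}³ 2¹⁵⁰ · 32ⁿ`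
  (`lcmUpto_pow_three_le`, `exists_lcmUpto_pow_three_le`).

The constant is not optimised (Hanson 1972 proves `dₙ < 3ⁿ`; the prime number theorem gives
`dₙ = e^{n(1+o(1))}`), and nothing here is specific to `ζ(3)`.

## References
* [Chebyshev1852] P. L. Chebyshev, Mémoire sur les nombres premiers, J. Math. Pures Appl. 17
  (1852) 366–390 (the `(2,3,5,30)` scheme, §§3–5).
* [VanDerPoorten1979] A. van der Poorten, A proof that Euler missed…, Math. Intelligencer 1
  (1979), §4 (where `dₙ³ (√2-1)^{4n} → 0` is what is needed).
-/

open Finset Nat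

namespace Literature.NumberTheory.LFunctions

/-! ### Legendre bookkeeping for Chebyshev's `(30,15,10,6 | 1)` scheme -/

/-- Chebyshev's periodic function `⌊x⌋ - ⌊x/2⌋ - ⌊x/3⌋ - ⌊x/5⌋ + ⌊x/30⌋ ∈ {0, 1}`, and it equals
`1` for `1 ≤ x < 6` — in the truncation-free form used below. [cite: Chebyshev1852, §3] -/
theorem chebyshev_floor_ineq (m : ℕ) :
    m / 2 + m / 3 + m / 5 + (if 1 ≤ m ∧ m ≤ 5 then 1 else 0) ≤ m + m / 30 := by
  split_ifs <;> omega

/-- The number of `i ≥ 1` with `n/6 < pⁱ ≤ n` is at least `log_p n - log_p (n/6)`. [folklore] -/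
theorem log_sub_log_le_sum_indicator {p : ℕ} (hp : p.Prime) (n : ℕ) {b : ℕ}
    (hb : Nat.log p n < b) :
    Nat.log p n ≤ Nat.log p (n / 6)
      + ∑ i ∈ Ico 1 b, (if 1 ≤ n / p ^ i ∧ n / p ^ i ≤ 5 then 1 else 0) := by
  set a := Nat.log p (n / 6)
  set c := Nat.log p n
  rcases le_or_gt c a with hca | hca
  · exact hca.trans (Nat.le_add_right _ _)
  have hn : n ≠ 0 := by
    rintro rfl
    simp [c] at hca
  have hsub : Ioc a c ⊆ Ico 1 b := by
    intro i hi
    rw [mem_Ioc] at hi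
    rw [mem_Ico]
    omega
  have hone : ∀ i ∈ Ioc a c, (if 1 ≤ n / p ^ i ∧ n / p ^ i ≤ 5 then 1 else 0) = 1 := by
    intro i hi
    rw [mem_Ioc] at hi
    have hpi : 0 < p ^ i := pow_pos hp.pos i
    have h1 : p ^ i ≤ n := (Nat.pow_le_pow_right hp.pos hi.2).trans (Nat.pow_log_le_self p hn)
    have h2 : n / 6 < p ^ i :=
      (Nat.lt_pow_succ_log_self hp.one_lt (n / 6)).trans_le (Nat.pow_le_pow_right hp.pos hi.1)
    rw [Nat.div_lt_iff_lt_mul (by norm_num)] at h2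
    have h3 : n / p ^ i ≤ 5 := by
      have : n / p ^ i < 6 := by
        rw [Nat.div_lt_iff_lt_mul hpi]; linarith
      omega
    have h4 : 1 ≤ n / p ^ i := (Nat.le_div_iff_mul_le hpi).mpr (by rwa [one_mul])
    simp [h3, h4]
  calc c = a + (c - a) := by omega
    _ = a + ∑ i ∈ Ioc a c, (if 1 ≤ n / p ^ i ∧ n / p ^ i ≤ 5 then 1 else 0) := by
        rw [sum_congr rfl hone, sum_const, smul_eq_mul, mul_one, Nat.card_Ioc]
    _ ≤ a + ∑ i ∈ Ico 1 b, (if 1 ≤ n / p ^ i ∧ n / p ^ i ≤ 5 then 1 else 0) :=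
        Nat.add_le_add_left (sum_le_sum_of_subset hsub) _

/-- **Legendre bookkeeping.** For every prime `p`:
`v_p(lcm(1..n)) + v_p(⌊n/2⌋!) + v_p(⌊n/3⌋!) + v_p(⌊n/5⌋!) ≤ v_p(n!) + v_p(⌊n/30⌋!) + v_p(lcm(1..⌊n/6⌋))`
(Legendre's formula `v_p(m!) = ∑ᵢ ⌊m/pⁱ⌋`, `v_p(lcm(1..n)) = ⌊log_p n⌋`, and `chebyshev_floor_ineq`).
[cite: Chebyshev1852, §§3–5] -/
theorem legendre_step {p : ℕ} (hp : p.Prime) (n : ℕ) :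
    Nat.log p n + (padicValNat p (n / 2)! + padicValNat p (n / 3)! + padicValNat p (n / 5)!) ≤
      padicValNat p n ! + padicValNat p (n / 30)! + Nat.log p (n / 6) := by
  haveI := Fact.mk hp
  set b := Nat.log p n + 1 with hbdef
  have hb : ∀ m, m ≤ n → Nat.log p m < b := fun m hm =>
    Nat.lt_succ_of_le (Nat.log_mono_right hm)
  rw [padicValNat_factorial (hb (n / 2) (Nat.div_le_self _ _)),
    padicValNat_factorial (hb (n / 3) (Nat.div_le_self _ _)),
    padicValNat_factorial (hb (n / 5) (Nat.div_le_self _ _)),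
    padicValNat_factorial (hb (n / 30) (Nat.div_le_self _ _)),
    padicValNat_factorial (hb n le_rfl)]
  have hind := log_sub_log_le_sum_indicator hp n (hb n le_rfl)
  have hkey : ∑ i ∈ Ico 1 b, (n / 2 / p ^ i) + ∑ i ∈ Ico 1 b, (n / 3 / p ^ i)
      + ∑ i ∈ Ico 1 b, (n / 5 / p ^ i)
      + ∑ i ∈ Ico 1 b, (if 1 ≤ n / p ^ i ∧ n / p ^ i ≤ 5 then 1 else 0) ≤
      ∑ i ∈ Ico 1 b, (n / p ^ i) + ∑ i ∈ Ico 1 b, (n / 30 / p ^ i) := by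
    rw [← sum_add_distrib, ← sum_add_distrib, ← sum_add_distrib, ← sum_add_distrib]
    apply sum_le_sum
    intro i _
    rw [Nat.div_right_comm n 2, Nat.div_right_comm n 3, Nat.div_right_comm n 5,
      Nat.div_right_comm n 30]
    exact chebyshev_floor_ineq (n / p ^ i)
  omega

/-- **The divisibility behind Chebyshev's bound**:
`lcm(1..n) · ⌊n/2⌋! ⌊n/3⌋! ⌊n/5⌋! ∣ n! · ⌊n/30⌋! · lcm(1..⌊n/6⌋)` (so `dₙ ≤ Cₙ d_{⌊n/6⌋}` with
Chebyshev's `Cₙ = n!⌊n/30⌋!/(⌊n/2⌋!⌊n/3⌋!⌊n/5⌋!)`). [cite: Chebyshev1852, §5] -/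
theorem lcmUpto_mul_factorials_dvd (n : ℕ) :
    Nat.lcmUpto n * ((n / 2)! * (n / 3)! * (n / 5)!) ∣ n ! * (n / 30)! * Nat.lcmUpto (n / 6) := by
  have hL := Nat.lcmUpto_ne_zero n
  have hL6 := Nat.lcmUpto_ne_zero (n / 6)
  have hf2 := factorial_ne_zero (n / 2)
  have hf3 := factorial_ne_zero (n / 3)
  have hf5 := factorial_ne_zero (n / 5)
  have hf30 := factorial_ne_zero (n / 30)
  have hfn := factorial_ne_zero n
  rw [← Nat.factorization_le_iff_dvd (by positivity) (by positivity), Finsupp.le_def]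
  intro p
  simp only [Nat.factorization_mul hL (mul_ne_zero (mul_ne_zero hf2 hf3) hf5),
    Nat.factorization_mul (mul_ne_zero hf2 hf3) hf5, Nat.factorization_mul hf2 hf3,
    Nat.factorization_mul (mul_ne_zero hfn hf30) hL6, Nat.factorization_mul hfn hf30,
    Finsupp.add_apply]
  by_cases hp : p.Prime
  · rw [Nat.factorization_lcmUpto _ hp, Nat.factorization_lcmUpto _ hp,
      Nat.factorization_def _ hp, Nat.factorization_def _ hp, Nat.factorization_def _ hp,
      Nat.factorization_def _ hp, Nat.factorization_def _ hp]
    have := legendre_step hp n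
    omega
  · simp [Nat.factorization_eq_zero_of_not_prime _ hp]

/-! ### The multinomial bound at multiples of `30` -/

/-- Entropy bound `2^{10k} C(15k, 5k) ≤ 3^{15k}` (the term `m = 10k` of `(2+1)^{15k}`). [folklore] -/
theorem two_pow_mul_choose_le (k : ℕ) :
    2 ^ (10 * k) * (15 * k).choose (5 * k) ≤ 3 ^ (15 * k) := by
  rw [show (3 : ℕ) = 2 + 1 by norm_num, add_pow]
  have hmem : 10 * k ∈ range (15 * k + 1) := mem_range.mpr (by omega)
  calc 2 ^ (10 * k) * (15 * k).choose (5 * k)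
      = 2 ^ (10 * k) * 1 ^ (15 * k - 10 * k) * (15 * k).choose (10 * k) := by
        rw [one_pow, mul_one, ← Nat.choose_symm (show 5 * k ≤ 15 * k by omega),
          show 15 * k - 5 * k = 10 * k by omega]
    _ ≤ ∑ m ∈ range (15 * k + 1), 2 ^ m * 1 ^ (15 * k - m) * (15 * k).choose m :=
        single_le_sum (f := fun m => 2 ^ m * 1 ^ (15 * k - m) * (15 * k).choose m)
          (fun _ _ => Nat.zero_le _) hmem

/-- `6^k ≤ C(6k, k)` (induction, `C(6k+6,k+1) = 6 C(6k+5,k) ≥ 6 C(6k,k)`). [folklore] -/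
theorem six_pow_le_choose (k : ℕ) : 6 ^ k ≤ (6 * k).choose k := by
  induction k with
  | zero => simp
  | succ k ih =>
    have h1 : (6 * k + 5 + 1) * (6 * k + 5).choose k = (6 * k + 5 + 1).choose (k + 1) * (k + 1) :=
      Nat.add_one_mul_choose_eq (6 * k + 5) k
    have h2 : (6 * k).choose k ≤ (6 * k + 5).choose k := Nat.choose_le_choose k (by omega)
    have h3 : (6 * (k + 1)).choose (k + 1) = (6 * k + 5 + 1).choose (k + 1) := by
      congr 1
    have h4 : 6 * (6 * k + 5).choose k = (6 * k + 5 + 1).choose (k + 1) := by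
      have h5 : (6 * k + 5 + 1) * (6 * k + 5).choose k = 6 * (6 * k + 5).choose k * (k + 1) := by
        ring
      rw [h5] at h1
      exact Nat.eq_of_mul_eq_mul_right (Nat.succ_pos k) h1
    rw [h3, ← h4]
    calc 6 ^ (k + 1) = 6 * 6 ^ k := by ring
      _ ≤ 6 * (6 * k).choose k := by gcongr
      _ ≤ 6 * (6 * k + 5).choose k := by gcongr

/-- **Multinomial bound**: `(30k)! k! ≤ 2^{19k} 3^{14k} (15k)! (10k)! (6k)!`, i.e. Chebyshev's
`C_{30k} = C(30k,15k) C(15k,5k)/C(6k,k) ≤ 2^{30k} (3^{15k} 2^{-10k}) 6^{-k}`. [folklore] -/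
theorem factorial_thirty_mul_le (k : ℕ) :
    (30 * k)! * k ! ≤ (2 ^ (19 * k) * 3 ^ (14 * k)) * ((15 * k)! * (10 * k)! * (6 * k)!) := by
  -- binomial decompositions
  have d1 : (30 * k).choose (15 * k) * (15 * k)! * (15 * k)! = (30 * k)! := by
    have := Nat.choose_mul_factorial_mul_factorial (show 15 * k ≤ 30 * k by omega)
    rwa [show 30 * k - 15 * k = 15 * k by omega] at this
  have d2 : (15 * k).choose (5 * k) * (5 * k)! * (10 * k)! = (15 * k)! := by
    have := Nat.choose_mul_factorial_mul_factorial (show 5 * k ≤ 15 * k by omega)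
    rwa [show 15 * k - 5 * k = 10 * k by omega] at this
  have d3 : (6 * k).choose k * k ! * (5 * k)! = (6 * k)! := by
    have := Nat.choose_mul_factorial_mul_factorial (show k ≤ 6 * k by omega)
    rwa [show 6 * k - k = 5 * k by omega] at this
  have b1 := Nat.choose_le_two_pow (30 * k) (15 * k)
  have b2 := two_pow_mul_choose_le k
  have b3 := six_pow_le_choose k
  have hc : 0 < (6 * k).choose k := Nat.choose_pos (by omega)
  have key : (30 * k)! * k ! * (6 * k).choose k =
      (30 * k).choose (15 * k) * (15 * k).choose (5 * k)
        * ((15 * k)! * (10 * k)! * (6 * k)!) := by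
    rw [← d1, ← d3, ← d2]
    ring
  have h12 : (30 * k).choose (15 * k) * (15 * k).choose (5 * k) ≤ 2 ^ (20 * k) * 3 ^ (15 * k) := by
    have h : 2 ^ (10 * k) * ((30 * k).choose (15 * k) * (15 * k).choose (5 * k)) ≤
        2 ^ (10 * k) * (2 ^ (20 * k) * 3 ^ (15 * k)) := by
      calc 2 ^ (10 * k) * ((30 * k).choose (15 * k) * (15 * k).choose (5 * k))
          = (30 * k).choose (15 * k) * (2 ^ (10 * k) * (15 * k).choose (5 * k)) := by ring
        _ ≤ 2 ^ (30 * k) * 3 ^ (15 * k) := Nat.mul_le_mul b1 b2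
        _ = 2 ^ (10 * k) * (2 ^ (20 * k) * 3 ^ (15 * k)) := by
            rw [← mul_assoc, ← pow_add, show 10 * k + 20 * k = 30 * k by ring]
    exact Nat.le_of_mul_le_mul_left h (by positivity)
  have hM : (2 ^ (19 * k) * 3 ^ (14 * k)) * 6 ^ k = 2 ^ (20 * k) * 3 ^ (15 * k) := by
    rw [show (6 : ℕ) = 2 * 3 from rfl, mul_pow,
      show 20 * k = 19 * k + k by ring, show 15 * k = 14 * k + k by ring, pow_add, pow_add]
    ring
  refine Nat.le_of_mul_le_mul_right ?_ hc
  calc (30 * k)! * k ! * (6 * k).choose k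
      = (30 * k).choose (15 * k) * (15 * k).choose (5 * k)
          * ((15 * k)! * (10 * k)! * (6 * k)!) := key
    _ ≤ 2 ^ (20 * k) * 3 ^ (15 * k) * ((15 * k)! * (10 * k)! * (6 * k)!) :=
        Nat.mul_le_mul_right _ h12
    _ = (2 ^ (19 * k) * 3 ^ (14 * k)) * 6 ^ k * ((15 * k)! * (10 * k)! * (6 * k)!) := by rw [hM]
    _ ≤ (2 ^ (19 * k) * 3 ^ (14 * k)) * (6 * k).choose k * ((15 * k)! * (10 * k)! * (6 * k)!) := by
        gcongr
    _ = (2 ^ (19 * k) * 3 ^ (14 * k)) * ((15 * k)! * (10 * k)! * (6 * k)!) * (6 * k).choose k := by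
        ring

/-! ### Iteration -/

/-- `lcm(1..m) ∣ lcm(1..n)` for `m ≤ n`. [folklore] -/
theorem lcmUpto_dvd_lcmUpto_of_le {m n : ℕ} (h : m ≤ n) : Nat.lcmUpto m ∣ Nat.lcmUpto n := by
  apply Finset.lcm_dvd
  intro i hi
  exact Finset.dvd_lcm (by rw [mem_Icc] at hi ⊢; omega)

/-- `lcm(1..m) ≤ lcm(1..n)` for `m ≤ n`. [folklore] -/
theorem lcmUpto_le_lcmUpto_of_le {m n : ℕ} (h : m ≤ n) : Nat.lcmUpto m ≤ Nat.lcmUpto n :=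
  Nat.le_of_dvd (Nat.lcmUpto_pos n) (lcmUpto_dvd_lcmUpto_of_le h)

/-- **Chebyshev step**: `lcm(1..30k) ≤ 2^{19k} 3^{14k} · lcm(1..5k)`. [cite: Chebyshev1852, §5] -/
theorem lcmUpto_thirty_mul_le (k : ℕ) :
    Nat.lcmUpto (30 * k) ≤ (2 ^ (19 * k) * 3 ^ (14 * k)) * Nat.lcmUpto (5 * k) := by
  have hdvd := lcmUpto_mul_factorials_dvd (30 * k)
  rw [show 30 * k / 2 = 15 * k by omega, show 30 * k / 3 = 10 * k by omega,
    show 30 * k / 5 = 6 * k by omega, show 30 * k / 30 = k by omega,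
    show 30 * k / 6 = 5 * k by omega] at hdvd
  have hle := Nat.le_of_dvd (Nat.mul_pos (by positivity) (Nat.lcmUpto_pos _)) hdvd
  have hX : 0 < (15 * k)! * (10 * k)! * (6 * k)! := by positivity
  refine Nat.le_of_mul_le_mul_right ?_ hX
  calc Nat.lcmUpto (30 * k) * ((15 * k)! * (10 * k)! * (6 * k)!)
      ≤ (30 * k)! * k ! * Nat.lcmUpto (5 * k) := hle
    _ ≤ (2 ^ (19 * k) * 3 ^ (14 * k)) * ((15 * k)! * (10 * k)! * (6 * k)!) * Nat.lcmUpto (5 * k) :=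
        Nat.mul_le_mul_right _ (factorial_thirty_mul_le k)
    _ = (2 ^ (19 * k) * 3 ^ (14 * k)) * Nat.lcmUpto (5 * k) * ((15 * k)! * (10 * k)! * (6 * k)!) := by
        ring

/-- Numerical heart of the iteration: `2^{19k} 3^{14k} · 2^{50⌈k/6⌉} ≤ 2^{50k}` for `k ≥ 125`
(from `3⁸⁴ < 2¹³⁴` and `2k ≥ 250`). [folklore] -/
theorem step_const_le {k : ℕ} (hk : 125 ≤ k) :
    (2 ^ (19 * k) * 3 ^ (14 * k)) * 2 ^ (50 * ((k + 5) / 6)) ≤ 2 ^ (50 * k) := by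
  set k' := (k + 5) / 6 with hk'
  have hk'le : 50 * k' * 6 ≤ 50 * k + 250 := by omega
  rw [← Nat.pow_le_pow_iff_left (show 6 ≠ 0 by norm_num)]
  have hpow : 3 ^ (14 * k * 6) ≤ 2 ^ (134 * k) := by
    rw [show 14 * k * 6 = 84 * k by ring, pow_mul, pow_mul]
    exact Nat.pow_le_pow_left (by norm_num) _
  calc ((2 ^ (19 * k) * 3 ^ (14 * k)) * 2 ^ (50 * k')) ^ 6
      = 2 ^ (19 * k * 6) * 3 ^ (14 * k * 6) * 2 ^ (50 * k' * 6) := by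
        rw [mul_pow, mul_pow, ← pow_mul, ← pow_mul, ← pow_mul]
    _ ≤ 2 ^ (19 * k * 6) * 2 ^ (134 * k) * 2 ^ (50 * k + 250) :=
        Nat.mul_le_mul (Nat.mul_le_mul_left _ hpow) (Nat.pow_le_pow_right (by norm_num) hk'le)
    _ ≤ (2 ^ (50 * k)) ^ 6 := by
        rw [← pow_add, ← pow_add, ← pow_mul]
        exact Nat.pow_le_pow_right (by norm_num) (by omega)

/-- The iteration: `lcm(1..30k) ≤ lcm(1..3750) · 2^{50k}` for every `k` (strong induction,
`d_{30k} ≤ 2^{19k}3^{14k} d_{5k} ≤ 2^{19k}3^{14k} d_{30⌈k/6⌉}`; below `k = 125` by monotonicity).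
[cite: Chebyshev1852, §5] -/
theorem lcmUpto_thirty_mul_le_pow (k : ℕ) :
    Nat.lcmUpto (30 * k) ≤ Nat.lcmUpto (30 * 125) * 2 ^ (50 * k) := by
  induction k using Nat.strong_induction_on with
  | _ k ih =>
    rcases lt_or_ge k 125 with hk | hk
    · calc Nat.lcmUpto (30 * k) ≤ Nat.lcmUpto (30 * 125) := lcmUpto_le_lcmUpto_of_le (by omega)
        _ ≤ Nat.lcmUpto (30 * 125) * 2 ^ (50 * k) :=
            Nat.le_mul_of_pos_right _ (pow_pos (by norm_num) _)
    · have h1 := lcmUpto_thirty_mul_le k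
      have h2 : Nat.lcmUpto (5 * k) ≤ Nat.lcmUpto (30 * ((k + 5) / 6)) :=
        lcmUpto_le_lcmUpto_of_le (by omega)
      have h3 := ih ((k + 5) / 6) (by omega)
      have h4 := step_const_le hk
      calc Nat.lcmUpto (30 * k) ≤ (2 ^ (19 * k) * 3 ^ (14 * k)) * Nat.lcmUpto (5 * k) := h1
        _ ≤ (2 ^ (19 * k) * 3 ^ (14 * k)) * (Nat.lcmUpto (30 * 125) * 2 ^ (50 * ((k + 5) / 6))) :=
            Nat.mul_le_mul_left _ (h2.trans h3)
        _ = Nat.lcmUpto (30 * 125) * ((2 ^ (19 * k) * 3 ^ (14 * k)) * 2 ^ (50 * ((k + 5) / 6))) := by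
            ring
        _ ≤ Nat.lcmUpto (30 * 125) * 2 ^ (50 * k) := Nat.mul_le_mul_left _ h4

/-- Explicit form of the bound: `lcm(1,…,n)³ ≤ lcm(1,…,3750)³ · 2¹⁵⁰ · 32ⁿ`. [cite: Chebyshev1852, §5] -/
theorem lcmUpto_pow_three_le (n : ℕ) :
    Nat.lcmUpto n ^ 3 ≤ Nat.lcmUpto (30 * 125) ^ 3 * 2 ^ 150 * 32 ^ n := by
  have hn : n ≤ 30 * (n / 30 + 1) := by omega
  have h1 : Nat.lcmUpto n ≤ Nat.lcmUpto (30 * 125) * 2 ^ (50 * (n / 30 + 1)) :=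
    (lcmUpto_le_lcmUpto_of_le hn).trans (lcmUpto_thirty_mul_le_pow (n / 30 + 1))
  have h2 : 2 ^ (150 * (n / 30 + 1)) ≤ 2 ^ 150 * 32 ^ n := by
    rw [show (32 : ℕ) = 2 ^ 5 by norm_num, ← pow_mul, ← pow_add]
    exact Nat.pow_le_pow_right (by norm_num) (by omega)
  have h3 : Nat.lcmUpto n ^ 3 ≤ (Nat.lcmUpto (30 * 125) * 2 ^ (50 * (n / 30 + 1))) ^ 3 :=
    Nat.pow_le_pow_left h1 3
  have h4 : (Nat.lcmUpto (30 * 125) * 2 ^ (50 * (n / 30 + 1))) ^ 3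
      = Nat.lcmUpto (30 * 125) ^ 3 * 2 ^ (150 * (n / 30 + 1)) := by
    rw [mul_pow, ← pow_mul, show 50 * (n / 30 + 1) * 3 = 150 * (n / 30 + 1) by ring]
  have h5 : Nat.lcmUpto (30 * 125) ^ 3 * 2 ^ (150 * (n / 30 + 1))
      ≤ Nat.lcmUpto (30 * 125) ^ 3 * (2 ^ 150 * 32 ^ n) := Nat.mul_le_mul_left _ h2
  calc Nat.lcmUpto n ^ 3 ≤ (Nat.lcmUpto (30 * 125) * 2 ^ (50 * (n / 30 + 1))) ^ 3 := h3
    _ = Nat.lcmUpto (30 * 125) ^ 3 * 2 ^ (150 * (n / 30 + 1)) := h4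
    _ ≤ Nat.lcmUpto (30 * 125) ^ 3 * (2 ^ 150 * 32 ^ n) := h5
    _ = Nat.lcmUpto (30 * 125) ^ 3 * 2 ^ 150 * 32 ^ n := (mul_assoc _ _ _).symm

/-- **Chebyshev-type bound for the cube of `lcm(1,…,n)`**: there is a constant `K > 0` with
`lcm(1,…,n)³ ≤ K · 32ⁿ` for all `n` (any exponential rate above `e^{3·1.1056}` would do; `32` is
what Apéry's argument needs, being `< (1+√2)⁴`). [cite: Chebyshev1852, §5] -/
theorem exists_lcmUpto_pow_three_le :
    ∃ K : ℕ, 0 < K ∧ ∀ n : ℕ, Nat.lcmUpto n ^ 3 ≤ K * 32 ^ n := by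
  refine ⟨_, ?_, lcmUpto_pow_three_le⟩
  exact Nat.mul_pos (pow_pos (Nat.lcmUpto_pos _) 3) (pow_pos (by norm_num) _)

end Literature.NumberTheory.LFunctions
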